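import Summits.ResolutionOfSingularities.ResolutionOfSingularities.Theorems.HomologicalConductorNoZenoFullSheafHartogs
import Literature.AlgebraicGeometry.Resolution.ResolutionOfSingularities
import HarnessLib

/-!
# G2 (ii): the global sections of the full sheaf are `φ(M)` — `Ȟ⁰(X, M̃) = φ(M)` for `M` reflexive

`[OURS · L W4.4]` Crux `HomologicalConductor.NoZenoR` (stmt-ResolutionOfSingularities-19943), line
`sandwich-cluster`, G-layer item **G2 (full-sheaf package), clause (ii)** — res-D-pv-045 AS res-L0-w44-stub-8's
CONTRACT 2026-08-27T05:25:23Z and HOLDER'S CUT 06:00:41Z; signature = `D/res-D-pv-045/SketchG2Split.lean` v2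
(`fullSheaf_range_fn_eq`, «(ii) unchanged» 06:36:24Z); seat res-D-pv-053 (TAKING 06:05:48Z).

For `T` a noetherian NORMAL domain, `π : X ⟶ Spec T` a RESOLUTION (only proper + birational are used), `M` a
REFLEXIVE `T`-module embedded by `φ : M →+ K(X)^r` semilinearly along `baseToFunctionField π : T → K(X)`, and
`M̃ := generatedSheaf (Fin r → K(X)) (Set.range φ)` (p500643), a vector `v ∈ K(X)^r` lies in EVERY stalk lattice
`𝒪_{X,x} · φ(M)` iff `v ∈ φ(M)`; with `range_fn_apply` (p500643) this says `Γ(X, M̃) = φ(M)`.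

Proof. (⊇) `subset_stalkSpan`. (⊆) res-L0-w44-stub-1's HARTOGS LEMMA FOR FULL SHEAVES
`mem_range_of_forall_height_le_one_mem_stalkSpan` (p505405: a proper birational `π` is an isomorphism at the stalks
over the primes of height `≤ 1` of the normal base — Zariski, `FundamentalLocus` — so there `𝒪_{X,x} · φ(M) = T_𝔭 · φ(M)`,
and a reflexive module is the intersection of its localisations at the height-one primes, [Matsumura 11.5 (ii)] /
[Bruns–Herzog 1.4.1]) applied to the hypothesis restricted to those points.  (An independent 290-line proof of the
same statement — clearing denominators through `isIso_stalkMap_of_valuationRing_stalk` and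
`Hironaka2005.isDiscreteValuationRing_of_height_eq_one` — is kept in the seat folder, `work/W44/…-standalone.lean`;
the tree needs one.)  Textbook geometry; replaces no printed item of the manuscript under review [Hironaka2017];
AI-written, weaker than expert review.  No definitions, no named facts, no local instances (stub-1's INSTANCE TRAP
06:29:56Z: this file never makes `stalkModule` a local instance, so every `•` below is the `Pi`/`K(X)` action).
[cite: Matsumura1987, Thm. 11.5 (ii)] [cite: BrunsHerzog1998, Prop. 1.4.1]

APPEND v2 (same seat, 07:1xZ; for res-L0-w44-stub-8's A5 device `sheafHomEquiv … GIVEN (ii) for M′`, 07:03:18Z):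
`range_fn_top_eq_range` (the value form `Γ(X, M̃) = φ(M)` through the tree's `range_fn_apply`),
`fullSheaf_pi_base_fn_eq` ((ii) for the FREE lattice `T^n ⊆ K(X)^n`, i.e. the `hH0` of `(T^n)~`), and the
linear-map currency forms `fullSheaf_range_linear_eq` / `…_of_isScalarTower` (any carrier `V`, any injective
`φ : M →ₗ[T] V`, `M` reflexive — verbatim the `hH0` slot of `endOfSheafEnd` / `sheafEndEquiv`, p507344).
-/

set_option linter.dupNamespace false

noncomputable section

universe u

open CategoryTheory AlgebraicGeometry TopologicalSpace Opposite
open Literature.AlgebraicGeometry.Resolution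

namespace Summit.ResolutionOfSingularities.ResolutionOfSingularities.Theorems.NoZeno.SandwichCluster.FullSheaf

variable (T : Type u) [CommRing T] [IsDomain T] [IsNoetherianRing T] [IsLocalRing T] [IsIntegrallyClosed T]
variable (X : Scheme.{u}) [IsIntegral X] [IsLocallyNoetherian X] (π : X ⟶ Spec (.of T))
variable (M : Type u) [AddCommGroup M] [Module T M] [Module.Finite T M]
variable {r : ℕ} (φ : M →+ (Fin r → X.functionField))

omit [IsLocalRing T] [IsLocallyNoetherian X] [Module.Finite T M] in
/-- **G2 (ii) — `Ȟ⁰(X, M̃) = φ(M)` for `M` reflexive** (res-D-pv-045 AS res-L0-w44-stub-8's split, signature of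
`D/res-D-pv-045/SketchG2Split.lean` v2; the sketch's instance binders `[IsLocalRing T] [IsLocallyNoetherian X]
[Module.Finite T M]` are unused and omitted, and `hdim : dim T = 2`, carried for the package, is the unused `_hdim` —
the explicit arguments are positionally those of the sketch): for `T` a noetherian normal domain, `π : X ⟶ Spec T` a
resolution of singularities, `M` REFLEXIVE with a `T`-semilinear embedding `φ : M →+ K(X)^r` along
`baseToFunctionField π`, a vector `v` lies in every stalk lattice `𝒪_{X,x} · φ(M)` iff `v ∈ φ(M)`.
(⊇ `subset_stalkSpan`; ⊆ res-L0-w44-stub-1's Hartogs lemma `mem_range_of_forall_height_le_one_mem_stalkSpan`, fed the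
hypothesis at the points over the primes of height `≤ 1`, with `IsProper π` / `IsBirational π` from `IsResolution`.)
[cite: Matsumura1987, Thm. 11.5 (ii)] [cite: BrunsHerzog1998, Prop. 1.4.1] -/
theorem fullSheaf_range_fn_eq (_hdim : ringKrullDim T = 2) (hπ : IsResolution π)
    (hM : Module.IsReflexive T M)
    (hφ : ∀ (a : T) (m : M), φ (a • m) = baseToFunctionField π a • φ m) (hφinj : Function.Injective φ)
    (v : Fin r → X.functionField) :
    (∀ x : X, v ∈ stalkSpan (X := X) (Fin r → X.functionField) (Set.range φ) x) ↔ v ∈ Set.range φ := by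
  haveI := hπ.isProper
  exact ⟨fun h => mem_range_of_forall_height_le_one_mem_stalkSpan π hπ.isBirational hM φ hφ hφinj
      fun x _ => h x, fun ⟨m, hm⟩ x => hm ▸ subset_stalkSpan _ _ x ⟨m, rfl⟩⟩

omit [IsLocalRing T] [IsLocallyNoetherian X] [Module.Finite T M] in
/-- **G2 (ii), `Set` form**: the vectors lying in every stalk lattice of `φ(M)` are exactly `φ(M)` —
`⋂ₓ (𝒪_{X,x} · φ(M)) = φ(M)`, i.e. `Γ(X, M̃) = φ(M)` read inside `K(X)^r`. [cite: Matsumura1987, Thm. 11.5 (ii)] -/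
theorem iInter_stalkSpan_range_eq (hdim : ringKrullDim T = 2) (hπ : IsResolution π)
    (hM : Module.IsReflexive T M)
    (hφ : ∀ (a : T) (m : M), φ (a • m) = baseToFunctionField π a • φ m) (hφinj : Function.Injective φ) :
    (⋂ x : X, (stalkSpan (X := X) (Fin r → X.functionField) (Set.range φ) x : Set (Fin r → X.functionField))) =
      Set.range φ := by
  ext v
  rw [Set.mem_iInter]
  exact fullSheaf_range_fn_eq T X π M φ hdim hπ hM hφ hφinj v

omit [IsLocalRing T] [IsLocallyNoetherian X] [Module.Finite T M] in
/-- **G2 (ii), global-sections form — `Γ(X, M̃) = φ(M)`**: the values (read at any point `x`, `fn`) of the GLOBAL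
sections of the full sheaf `M̃ = generatedSheaf (K(X)^r) (φ(M))` are exactly `φ(M)` ((ii) composed with the tree's
`range_fn_apply`, p500643: the value range over `U` is `⋂_{y ∈ U} 𝒪_{X,y} · φ(M)`). [cite: Matsumura1987, Thm. 11.5 (ii)] -/
theorem range_fn_top_eq_range (hdim : ringKrullDim T = 2) (hπ : IsResolution π)
    (hM : Module.IsReflexive T M)
    (hφ : ∀ (a : T) (m : M), φ (a • m) = baseToFunctionField π a • φ m) (hφinj : Function.Injective φ) (x : X) :
    Set.range (fun s : Γ(generatedSheaf (Fin r → X.functionField) (Set.range φ), ⊤) =>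
        fn (Fin r → X.functionField) (Set.range φ) s ⟨x, trivial⟩) = Set.range φ := by
  rw [range_fn_apply]
  ext v
  rw [← fullSheaf_range_fn_eq T X π M φ hdim hπ hM hφ hφinj v, Set.mem_iInter]
  exact ⟨fun h y => h ⟨y, trivial⟩, fun h y => h y.1⟩

omit [IsLocalRing T] [IsLocallyNoetherian X] in
/-- **`Γ(X, 𝒪_X^n) = T^n` in full-sheaf currency** (the `hH0` of the FREE lattice, G2 A5 input): for the diagonal
embedding `φ_n : T^n → K(X)^n` along `baseToFunctionField π` (injective: `K(X) = Frac T`; `T`-semilinear: `map_mul`),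
a vector of `K(X)^n` lies in every stalk lattice `𝒪_{X,x} · T^n` iff it lies in `T^n` — (ii) at the reflexive module
`M := T^n`.  For `n = 1` this is `H⁰(X, 𝒪_X) = T` (tree twin: `IsResolution.exists_baseToFunctionField_eq_of_forall_isRegularAt`).
[cite: Hartshorne1977, proof of Cor. III.11.4 (p. 280)] -/
theorem fullSheaf_pi_base_fn_eq (hdim : ringKrullDim T = 2) (hπ : IsResolution π) (n : ℕ)
    (v : Fin n → X.functionField) :
    (∀ x : X, v ∈ stalkSpan (X := X) (Fin n → X.functionField)
        (Set.range (((baseToFunctionField π).compLeft (Fin n)).toAddMonoidHom)) x) ↔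
      v ∈ Set.range (((baseToFunctionField π).compLeft (Fin n)).toAddMonoidHom) := by
  haveI := hπ.isBirational.isIso_stalkMap_genericPoint
  have hinj : Function.Injective (baseToFunctionField π) := baseToFunctionField_injective π (genericPoint X)
  refine fullSheaf_range_fn_eq T X π (Fin n → T) _ hdim hπ inferInstance ?_ ?_ v
  · intro a m
    funext i
    simp only [RingHom.toAddMonoidHom_eq_coe, AddMonoidHom.coe_coe, RingHom.compLeft_apply, Function.comp_apply,
      Pi.smul_apply, smul_eq_mul, map_mul]
  · intro a b h
    funext i
    exact hinj (congr_fun h i)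

/-! ## (ii) in the linear-map currency of the assembly (`hH0` of `…FullSheafEndEquiv`, p507344) -/

section Linear

variable {T : Type u} [CommRing T] [IsDomain T] [IsNoetherianRing T] [IsIntegrallyClosed T]
variable {X : Scheme.{u}} [IsIntegral X] (π : X ⟶ Spec (.of T))
variable {V : Type u} [AddCommGroup V] [Module X.functionField V] [Module T V]
variable {M : Type u} [AddCommGroup M] [Module T M]

/-- **G2 (ii) for any carrier and a LINEAR embedding — the `hH0` of the assembly.**  `T` a noetherian normal
domain acting on the `K(X)`-vector space `V` through `baseToFunctionField π` (`hmod`; e.g. the `IsScalarTower`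
convention of `…FullSheafEndLift/EndEquiv` with `algebraMap T K(X) = baseToFunctionField π`), `π : X ⟶ Spec T` a
resolution, `M` REFLEXIVE, `φ : M →ₗ[T] V` injective: a vector lies in every stalk lattice `𝒪_{X,x} · φ(M)` iff it
lies in `φ(M)` — verbatim the hypothesis `hH0` of `endOfSheafEnd` / `sheafEndEquiv` (p507344), hence G2 (v) for
reflexive `M` is unconditional.  (res-L0-w44-stub-1's `mem_of_forall_height_le_one_mem_stalkSpan` at `N := range φ`,
reflexive as `≅ M`.) [cite: Matsumura1987, Thm. 11.5 (ii)] -/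
theorem fullSheaf_range_linear_eq (hπ : IsResolution π)
    (hmod : ∀ (a : T) (w : V), a • w = baseToFunctionField π a • w)
    (hM : Module.IsReflexive T M) (φ : M →ₗ[T] V) (hφinj : Function.Injective φ) (v : V) :
    (∀ x : X, v ∈ stalkSpan (X := X) V (Set.range φ) x) ↔ v ∈ Set.range φ := by
  haveI := hπ.isProper
  haveI := hM
  haveI : Module.IsReflexive T (LinearMap.range φ) := Module.equiv (LinearEquiv.ofInjective φ hφinj)
  refine ⟨fun h => ?_, fun ⟨m, hm⟩ x => hm ▸ subset_stalkSpan _ _ x ⟨m, rfl⟩⟩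
  have hv : v ∈ LinearMap.range φ :=
    mem_of_forall_height_le_one_mem_stalkSpan π hπ.isBirational hmod (LinearMap.range φ) fun x _ => by
      rw [LinearMap.coe_range]; exact h x
  exact LinearMap.mem_range.mp hv

/-- The same under the `IsScalarTower` convention of `…FullSheafEndLift/EndEquiv` (`T → K(X)` an algebra with
`algebraMap = baseToFunctionField π`, `V` a `T`-module through it). [cite: Matsumura1987, Thm. 11.5 (ii)] -/
theorem fullSheaf_range_linear_eq_of_isScalarTower [Algebra T X.functionField] [IsScalarTower T X.functionField V]
    (halg : algebraMap T X.functionField = baseToFunctionField π) (hπ : IsResolution π)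
    (hM : Module.IsReflexive T M) (φ : M →ₗ[T] V) (hφinj : Function.Injective φ) (v : V) :
    (∀ x : X, v ∈ stalkSpan (X := X) V (Set.range φ) x) ↔ v ∈ Set.range φ :=
  fullSheaf_range_linear_eq π hπ (fun a w => by rw [← halg, algebraMap_smul]) hM φ hφinj v

end Linear

end Summit.ResolutionOfSingularities.ResolutionOfSingularities.Theorems.NoZeno.SandwichCluster.FullSheaf

end
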